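import Literature.NumberTheory.EllipticCurves.ShaIsogenyProofs
import Literature.NumberTheory.EllipticCurves.IsogenyGroundFieldExtensionProofs
import Literature.NumberTheory.EllipticCurves.IsogenyGeomEndRingProofs
import HarnessLib

/-!
# Base change of an isogeny to an ARBITRARY extension of the ground field is an isogeny

Topic `NumberTheory/EllipticCurves`; `Proofs` file (theorems only, no definitions, no named facts), companion of
`IsogenyBaseChange` / `ShaIsogenyProofs` (the base change `φ_{K̄_E}` of a `K`-isogeny `φ : E → E'` to the local points
`E(K̄_E)`, `WeierstrassCurve.Isogeny.localPointsMap`) and of `IsogenyGroundFieldExtensionProofs` (ALGEBRAIC `L/K` only).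

For a `K`-isogeny `φ` (its `Γ_K`-equivariant action on `K̄`-points, agreeing with a rational map `(P₁/Q₁, P₂/Q₂)`,
`Pᵢ, Qᵢ ∈ K̄[x, y]`, off a finite set) and an ARBITRARY field `E ⊇ K` — typically a completion `K_v`, transcendental
over `K` — the map `φ_E := φ.localPointsMap E` read on `E_E(K̄_E) = E(K̄_E)` (`localPointsEquivGeomPoints`) is an
isogeny over `E`:
* `Isogeny.localPointsMap_transport_some_of_not_mem_range` — at a point of `E(K̄_E)` NOT in `ι_* E(K̄)` (`ι = closureEmb E`)
  `φ_E` IS the rational map `(P₁^ι/Q₁^ι, P₂^ι/Q₂^ι)` with non-vanishing denominators (`baseChangeFun_some_of_generic`);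
* `Isogeny.isAlgebraicOn_localPointsMap` — `φ_E` is ALGEBRAIC over `K̄_E`, exceptional set `⊆ ι_*(exc)` (on `ι_* E(K̄)`:
  the tree's `agreesWithRationalMapAt_transport`); `Isogeny.natCard_ker_localPointsMap_transport` — `ker φ_E = ι_* ker φ`;
* **`Isogeny.exists_baseChange_field`** — an isogeny `φ_E : E_E → E'_E` DEFINED OVER `E` with `φ_E ∘ ι_* = ι_* ∘ φ` and
  `#ker φ_E = #ker φ`: "an isogeny defined over `K` is defined over every field `E ⊇ K`" (Silverman, *AEC*, III.§4 with
  I.§3, II.§2), for the tree's encoding and WITHOUT the algebraicity of `E/K` of `Isogeny.exists_baseChange_groundField`;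
* rigidity (`eq_of_mem_geomEndRing_of_eqOn_infinite`: two elements of `End_{F̄}(V)` agreeing on an infinite set coincide —
  `mem_geomEndRing_iff_holds` + `IsAlgebraicOn.finite_ker`) and, for ANY `E`-isogeny `φ_E` compatible with an endo-isogeny
  `φ` along `ι_*`: quadratic relations `φ² + mφ = c` transfer (`Isogeny.apply_apply_add_smul_of_baseChange_field`), `1 − φ`
  transfers (`Isogeny.eq_sub_of_baseChange_field`, `Isogeny.natCard_ker_one_sub_of_baseChange_field`) — what a CM
  endomorphism `π` (`π² = π − 2`, `π̄ = 1 − π`) needs over completions (cell `bsd-print-cf2`, local descent of `Ш`).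

References: [SilvermanAEC2009] I.§3 (Remark 3.1, `φ^σ`), II.2.1, III.§4 (Thm. III.4.8, Cor. III.4.9); [SerreGaloisCohomology1997]
II.§1.1. Design: no definition — the transported map is written out and packaged existentially; the `K̄`-algebra structure
on `K̄_E` is the local instance `(closureEmb E).toRingHom.toAlgebra` of `ShaIsogenyProofs`; `K E : Type u` in one universe.
-/

noncomputable section

open scoped Classical

universe u
namespace WeierstrassCurve

open Literature.NumberTheory.EllipticCurves Field
open _root_.WeierstrassCurve.geomPoints

variable {K : Type u} [Field K] (E : Type u) [Field E] [Algebra K E] {W W' : WeierstrassCurve K}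

/-! ## §1 Points of `E(K̄_E)` off `ι_* E(K̄)`: `φ_E` is the rational map there -/

namespace Isogeny

/-- The transport `ι_* = (E(K̄_E) = E_E(K̄_E)) ∘ pointsMap` on an affine point:
`ι_* (x, y) = (ι x, ι y)` for the chosen embedding `ι = closureEmb E`. Silverman, *AEC*, VIII.§1 (points over extensions).
[cite: SilvermanAEC2009, VIII.§1] -/
theorem localPointsEquivGeomPoints_pointsMap_some (W : WeierstrassCurve K) {x y : AlgebraicClosure K}
    (h : (W.baseChange (AlgebraicClosure K)).toAffine.Nonsingular x y) :
    ∃ h', localPointsEquivGeomPoints W E (pointsMap W E (.some x y h)) =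
      (.some (closureEmb (K := K) E x) (closureEmb (K := K) E y) h' :
        geomPoints (W.baseChange E)) :=
  localPointsEquivGeomPoints_pointsMapOfEmb_some E W (closureEmb (K := K) E) h

/-- `(E(K̄_E) = E_E(K̄_E))⁻¹` is the identity on coordinates. Silverman, *AEC*, VIII.§1. [cite: SilvermanAEC2009, VIII.§1] -/
theorem localPointsEquivGeomPoints_symm_some (W : WeierstrassCurve K) {x y : AlgebraicClosure E}
    (h : ((W.baseChange E).baseChange (AlgebraicClosure E)).toAffine.Nonsingular x y) :
    ∃ h', (localPointsEquivGeomPoints W E).symm (.some x y h) = (.some x y h' : localPoints W E) := by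
  have h' : (W.baseChange (AlgebraicClosure E)).toAffine.Nonsingular x y :=
    baseChange_baseChange W E (AlgebraicClosure E) ▸ h
  refine ⟨h', (localPointsEquivGeomPoints W E).injective ?_⟩
  rw [AddEquiv.apply_symm_apply]
  change Affine.Point.some x y h = pointsCongr W E (AlgebraicClosure E) (Affine.Point.some x y h')
  rw [pointsCongr, Affine.Point.congrEquiv_some]

/-- `E(K̄_E) = E_E(K̄_E)` is the identity on coordinates. Silverman, *AEC*, VIII.§1. [cite: SilvermanAEC2009, VIII.§1] -/
theorem localPointsEquivGeomPoints_some (W : WeierstrassCurve K) {x y : AlgebraicClosure E}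
    (h : (W.baseChange (AlgebraicClosure E)).toAffine.Nonsingular x y) :
    ∃ h', localPointsEquivGeomPoints W E (show localPoints W E from .some x y h) =
      (.some x y h' : geomPoints (W.baseChange E)) := by
  change ∃ h', pointsCongr W E (AlgebraicClosure E) (Affine.Point.some x y h) = _
  rw [pointsCongr, Affine.Point.congrEquiv_some]
  exact ⟨_, rfl⟩

variable (φ : Isogeny W W')

/-- **`φ_E` extends `φ` along `ι_*`** (`localPointsMap_pointsMap` read on `E_E(K̄_E)`):
`φ_E (ι_* P) = ι_* (φ P)`. Silverman, *AEC*, III.§4 (base change of an isogeny). [cite: SilvermanAEC2009, III.§4 (Definition, p. 66)] -/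
theorem localPointsMap_transport_apply (P : W.geomPoints) :
    localPointsEquivGeomPoints W' E (φ.localPointsMap E ((localPointsEquivGeomPoints W E).symm
        (localPointsEquivGeomPoints W E (pointsMap W E P)))) =
      localPointsEquivGeomPoints W' E (pointsMap W' E (φ P)) := by
  rw [AddEquiv.symm_apply_apply, localPointsMap_pointsMap]

/-- **At a point of `E_E(K̄_E)` off `ι_* E(K̄)`, `φ_E` is the rational map.** For the chosen representation
`ρ = (P₁, Q₁, P₂, Q₂)` of `φ` (`Isogeny.ratRep`) and `ι = closureEmb E`: if the affine point `(x, y)` of `E_E(K̄_E)` is not of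
the form `ι_* P`, then `Q₁^ι(x, y) ≠ 0`, `Q₂^ι(x, y) ≠ 0` and `φ_E (x, y) = (P₁^ι/Q₁^ι, P₂^ι/Q₂^ι)(x, y)` — the point is
generic (`x ∉ ι(K̄)`), where the base change is the rational map (`baseChangeFun_some_of_generic`,
`RatRep.aeval_ne_zero_of_generic`). Silverman, *AEC*, I.§3 (Remark 3.1: a rational map over `K` is one over any
`E ⊇ K`), II.2.1. [cite: SilvermanAEC2009, I.§3 Remark 3.1 and II.2.1] -/
theorem localPointsMap_transport_some_of_not_mem_range {x y : AlgebraicClosure E}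
    (h : ((W.baseChange E).baseChange (AlgebraicClosure E)).toAffine.Nonsingular x y)
    (hmem : (Affine.Point.some x y h : geomPoints (W.baseChange E)) ∉
      Set.range fun P : W.geomPoints ↦ localPointsEquivGeomPoints W E (pointsMap W E P)) :
    MvPolynomial.eval ![x, y] (φ.ratRep.Q₁.map (closureEmb (K := K) E).toRingHom) ≠ 0 ∧
    MvPolynomial.eval ![x, y] (φ.ratRep.Q₂.map (closureEmb (K := K) E).toRingHom) ≠ 0 ∧
    ∃ h', localPointsEquivGeomPoints W' E (φ.localPointsMap E
        ((localPointsEquivGeomPoints W E).symm (.some x y h))) =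
      (.some
        (MvPolynomial.eval ![x, y] (φ.ratRep.P₁.map (closureEmb (K := K) E).toRingHom) /
          MvPolynomial.eval ![x, y] (φ.ratRep.Q₁.map (closureEmb (K := K) E).toRingHom))
        (MvPolynomial.eval ![x, y] (φ.ratRep.P₂.map (closureEmb (K := K) E).toRingHom) /
          MvPolynomial.eval ![x, y] (φ.ratRep.Q₂.map (closureEmb (K := K) E).toRingHom)) h' :
        geomPoints (W'.baseChange E)) := by
  letI : Algebra (AlgebraicClosure K) (AlgebraicClosure E) :=
    (closureEmb (K := K) E).toRingHom.toAlgebra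
  haveI : IsScalarTower K (AlgebraicClosure K) (AlgebraicClosure E) :=
    IsScalarTower.of_algebraMap_eq fun x ↦ ((closureEmb (K := K) E).commutes x).symm
  have hι : IsScalarTower.toAlgHom K (AlgebraicClosure K) (AlgebraicClosure E) =
      closureEmb (K := K) E :=
    AlgHom.ext fun _ ↦ rfl
  obtain ⟨hR, eR⟩ := localPointsEquivGeomPoints_symm_some E W h
  -- `(x, y) ∈ E(K̄_E)` is not in `ι_* E(K̄)`
  have hmem' : (Affine.Point.some x y hR : (W.baseChange (AlgebraicClosure E)).toAffine.Point) ∉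
      Set.range (Affine.Point.map (W' := W)
        (IsScalarTower.toAlgHom K (AlgebraicClosure K) (AlgebraicClosure E))) := by
    rintro ⟨P₀, hP₀⟩
    refine hmem ⟨P₀, ?_⟩
    change localPointsEquivGeomPoints W E (pointsMap W E P₀) = _
    have e1 : pointsMap W E P₀ = (show localPoints W E from Affine.Point.some x y hR) := by
      rw [← hP₀, hι]; rfl
    rw [e1, ← eR, AddEquiv.apply_symm_apply]
  have hx := (not_mem_range_of_not_mem_range_map hR hmem').1
  -- `aeval` over the `K̄`-algebra `K̄_E` is `eval` of the `ι`-image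
  have haeval : ∀ p : MvPolynomial (Fin 2) (AlgebraicClosure K),
      MvPolynomial.aeval ![x, y] p = MvPolynomial.eval ![x, y] (p.map (closureEmb (K := K) E).toRingHom) :=
    fun p ↦ by rw [MvPolynomial.eval_map, MvPolynomial.aeval_def]; rfl
  obtain ⟨hQ₁, hQ₂⟩ := φ.ratRep.aeval_ne_zero_of_generic hR hx
  rw [haeval] at hQ₁ hQ₂
  refine ⟨hQ₁, hQ₂, ?_⟩
  have key := φ.baseChangeFun_some_of_generic hR hmem'
  rw [eR]
  change ∃ h', localPointsEquivGeomPoints W' E (φ.baseChange (Affine.Point.some x y hR)) = _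
  rw [baseChange_apply, key]
  obtain ⟨h'', e''⟩ := localPointsEquivGeomPoints_some E W'
    (φ.ratRep.nonsingular_aeval_of_generic hR hx)
  rw [e'']
  exact Affine.Point.exists_eq_some_of_eq rfl (by rw [haeval, haeval]) (by rw [haeval, haeval])

/-- A point of `E_E(K̄_E)` off `ι_* E(K̄)` has NON-ZERO image under `φ_E` (the image is an affine
point). Silverman, *AEC*, I.§3, II.2.1. [cite: SilvermanAEC2009, I.§3 Remark 3.1 and II.2.1] -/
theorem localPointsMap_transport_ne_zero_of_not_mem_range {Q : geomPoints (W.baseChange E)}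
    (hmem : Q ∉ Set.range fun P : W.geomPoints ↦ localPointsEquivGeomPoints W E (pointsMap W E P)) :
    localPointsEquivGeomPoints W' E (φ.localPointsMap E ((localPointsEquivGeomPoints W E).symm Q)) ≠ 0 := by
  rcases Q with _ | ⟨x, y, h⟩
  · refine (hmem ⟨0, ?_⟩).elim
    change localPointsEquivGeomPoints W E (pointsMap W E 0) = 0
    rw [map_zero, map_zero]
  · obtain ⟨-, -, h', e'⟩ := φ.localPointsMap_transport_some_of_not_mem_range E h hmem
    rw [e']
    exact Affine.Point.some_ne_zero h'

/-! ## §2 `φ_E` is algebraic over `K̄_E`, with kernel `ι_* ker φ`, and `Γ_E`-equivariant -/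

/-- **The base change of an isogeny to `E(K̄_E)` is algebraic over `K̄_E`.** For a `K`-isogeny
`φ : E → E'` and any field `E ⊇ K`, the transported map `φ_E` on `E_E(K̄_E)` agrees with the rational
map `(P₁^ι/Q₁^ι, P₂^ι/Q₂^ι)` (`ι = closureEmb E` applied to the coefficients of a representation of
`φ`) off the finite set `ι_*(exc)`: at the points `ι_* P`, `P ∉ exc`, by transport
(`agreesWithRationalMapAt_transport`, `φ_E ∘ ι_* = ι_* ∘ φ`), and at all other points because there
`φ_E` IS the rational map (`localPointsMap_transport_some_of_not_mem_range`). Silverman, *AEC*,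
I.§3 (Remark 3.1: a rational map over `K` is a rational map over any `E ⊇ K`), III.§4.
[cite: SilvermanAEC2009, I.§3 Remark 3.1 and III.§4] -/
theorem isAlgebraicOn_localPointsMap :
    IsAlgebraicOn (W.baseChange E) (W'.baseChange E) fun Q ↦
      localPointsEquivGeomPoints W' E (φ.localPointsMap E ((localPointsEquivGeomPoints W E).symm Q)) := by
  set ι := (closureEmb (K := K) E).toRingHom with hι
  refine ⟨φ.ratRep.P₁.map ι, φ.ratRep.Q₁.map ι, φ.ratRep.P₂.map ι, φ.ratRep.Q₂.map ι, ?_⟩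
  refine ((φ.ratRep.exc.finite_toSet).image fun P ↦
    localPointsEquivGeomPoints W E (pointsMap W E P)).subset fun Q hQ ↦ ?_
  by_contra hmemexc
  apply hQ
  by_cases hrange : Q ∈ Set.range fun P : W.geomPoints ↦
      localPointsEquivGeomPoints W E (pointsMap W E P)
  · obtain ⟨P, rfl⟩ := hrange
    have hP : P ∉ φ.ratRep.exc := fun h ↦ hmemexc ⟨P, h, rfl⟩
    exact agreesWithRationalMapAt_transport E W W' (closureEmb (K := K) E)
      (g := fun Q ↦ localPointsEquivGeomPoints W' E
        (φ.localPointsMap E ((localPointsEquivGeomPoints W E).symm Q)))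
      (fun P ↦ φ.localPointsMap_transport_apply E P) (φ.ratRep.agrees_of_not_mem_exc hP)
  · rcases Q with _ | ⟨x, y, h⟩
    · refine (hrange ⟨0, ?_⟩).elim
      change localPointsEquivGeomPoints W E (pointsMap W E 0) = 0
      rw [map_zero, map_zero]
    · obtain ⟨hQ₁, hQ₂, h', e'⟩ := φ.localPointsMap_transport_some_of_not_mem_range E h hrange
      rw [agreesWithRationalMapAt_iff, xy_some]
      exact ⟨Affine.Point.some_ne_zero h, hQ₁, hQ₂, h', e'⟩

/-- `ι_* : E(K̄) → E_E(K̄_E)` is injective. Silverman, *AEC*, VIII.§1. [cite: SilvermanAEC2009, VIII.§1] -/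
theorem localPointsEquivGeomPoints_pointsMap_injective (W : WeierstrassCurve K) :
    Function.Injective fun P : W.geomPoints ↦ localPointsEquivGeomPoints W E (pointsMap W E P) :=
  (localPointsEquivGeomPoints W E).injective.comp (pointsMapOfEmb_injective W (closureEmb (K := K) E))

/-- **`ker φ_E = ι_* ker φ`**: the kernel of the base change consists of the images of the kernel of
`φ` (points off `ι_* E(K̄)` have affine, non-zero images), so `#ker φ_E = #ker φ` — in
characteristic `0`, `deg φ_E = deg φ` for the tree's `Isogeny.degree`. Silverman, *AEC*, III.§4
(Cor. 4.9; the degree of an isogeny does not depend on the field of definition).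
[cite: SilvermanAEC2009, III.4.9] -/
theorem natCard_ker_localPointsMap_transport
    (g : geomPoints (W.baseChange E) →+ geomPoints (W'.baseChange E))
    (hg : ∀ Q, g Q = localPointsEquivGeomPoints W' E
      (φ.localPointsMap E ((localPointsEquivGeomPoints W E).symm Q))) :
    Nat.card g.ker = Nat.card φ.toAddMonoidHom.ker := by
  have hinj := localPointsEquivGeomPoints_pointsMap_injective E W
  have hinj' := localPointsEquivGeomPoints_pointsMap_injective E W'
  let f : φ.toAddMonoidHom.ker → g.ker := fun P ↦
    ⟨localPointsEquivGeomPoints W E (pointsMap W E (P : W.geomPoints)), by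
      rw [AddMonoidHom.mem_ker, hg, φ.localPointsMap_transport_apply E]
      have hP : φ (P : W.geomPoints) = 0 := (AddMonoidHom.mem_ker).mp P.2
      rw [hP, map_zero, map_zero]⟩
  refine (Nat.card_congr (Equiv.ofBijective f ⟨fun P₁ P₂ h ↦ ?_, fun Q ↦ ?_⟩)).symm
  · exact Subtype.ext (hinj (congrArg Subtype.val h))
  · have hQ : g (Q : geomPoints (W.baseChange E)) = 0 := (AddMonoidHom.mem_ker).mp Q.2
    by_cases hrange : (Q : geomPoints (W.baseChange E)) ∈ Set.range fun P : W.geomPoints ↦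
        localPointsEquivGeomPoints W E (pointsMap W E P)
    · obtain ⟨P, hP⟩ := hrange
      refine ⟨⟨P, (AddMonoidHom.mem_ker).mpr ?_⟩, Subtype.ext hP⟩
      rw [← hP, hg, φ.localPointsMap_transport_apply E] at hQ
      have h0 : localPointsEquivGeomPoints W' E (pointsMap W' E (φ P)) =
          localPointsEquivGeomPoints W' E (pointsMap W' E 0) := by rw [hQ, map_zero, map_zero]
      exact hinj' h0
    · rw [hg] at hQ
      exact (φ.localPointsMap_transport_ne_zero_of_not_mem_range E hrange hQ).elim

/-- **`φ_E` is `Γ_E`-equivariant on `E_E(K̄_E)`** (`localPointsMap_smul` and the equivariance of the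
identification `E(K̄_E) = E_E(K̄_E)`, `localPointsEquivGeomPoints_smul`). Serre, *Galois Cohomology*,
II.§1.1; Silverman, *AEC*, I.§3 Ex. 1.12(c). [cite: SilvermanAEC2009, I.§3 Ex. 1.12(c)] -/
theorem localPointsMap_transport_smul (σ : absoluteGaloisGroup E) (Q : geomPoints (W.baseChange E)) :
    localPointsEquivGeomPoints W' E (φ.localPointsMap E ((localPointsEquivGeomPoints W E).symm (σ • Q))) =
      σ • localPointsEquivGeomPoints W' E (φ.localPointsMap E ((localPointsEquivGeomPoints W E).symm Q)) := by
  have h1 : (localPointsEquivGeomPoints W E).symm (σ • Q) = σ • (localPointsEquivGeomPoints W E).symm Q := by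
    apply (localPointsEquivGeomPoints W E).injective
    rw [AddEquiv.apply_symm_apply, localPointsEquivGeomPoints_smul, AddEquiv.apply_symm_apply]
  rw [h1, localPointsMap_smul, localPointsEquivGeomPoints_smul]

/-! ## §3 The isogeny over `E` -/

/-- **Base change of a `K`-isogeny to an ARBITRARY field `E ⊇ K`.** For an isogeny `φ : E → E'`
defined over `K` and any field extension `E` of `K` (algebraic or not — e.g. a completion `K_v`)
there is an isogeny `φ_E : E_E → E'_E` DEFINED OVER `E` (a term of
`Isogeny (W.baseChange E) (W'.baseChange E)`) with `φ_E (ι_* P) = ι_* (φ P)` on `E(K̄)`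
(`ι_* P = localPointsEquivGeomPoints W E (pointsMap W E P)`) and `#ker φ_E = #ker φ`: namely the base
change `φ.localPointsMap E` (`Isogeny.baseChange`), algebraic by `isAlgebraicOn_localPointsMap`,
`Γ_E`-equivariant by `localPointsMap_transport_smul`, of finite kernel `ι_* ker φ`. Silverman,
*AEC*, III.§4 (an isogeny over `K` is a morphism over `K̄` fixed by `G_{K̄/K}`; base change),
I.§3, II.2.1. [cite: SilvermanAEC2009, III.§4 (Definition, p. 66) with I.§3 Remark 3.1] -/
theorem exists_baseChange_field :
    ∃ φE : Isogeny (W.baseChange E) (W'.baseChange E),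
      (∀ P : W.geomPoints, φE (localPointsEquivGeomPoints W E (pointsMap W E P)) =
        localPointsEquivGeomPoints W' E (pointsMap W' E (φ P))) ∧
      (∀ Q, φE Q = localPointsEquivGeomPoints W' E
        (φ.localPointsMap E ((localPointsEquivGeomPoints W E).symm Q))) ∧
      Nat.card φE.toAddMonoidHom.ker = Nat.card φ.toAddMonoidHom.ker := by
  let g : geomPoints (W.baseChange E) →+ geomPoints (W'.baseChange E) :=
    ((localPointsEquivGeomPoints W' E).toAddMonoidHom.comp (φ.localPointsMap E)).comp
      (localPointsEquivGeomPoints W E).symm.toAddMonoidHom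
  have hg : ∀ Q, g Q = localPointsEquivGeomPoints W' E
      (φ.localPointsMap E ((localPointsEquivGeomPoints W E).symm Q)) := fun _ ↦ rfl
  have halg : IsAlgebraicOn (W.baseChange E) (W'.baseChange E) g :=
    φ.isAlgebraicOn_localPointsMap E
  refine ⟨⟨g, halg, fun σ Q ↦ ?_, halg.finite_ker⟩, fun P ↦ ?_, fun Q ↦ rfl,
    φ.natCard_ker_localPointsMap_transport E g hg⟩
  · exact φ.localPointsMap_transport_smul E σ Q
  · change g _ = _
    rw [hg, φ.localPointsMap_transport_apply E]

end Isogeny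

/-! ## §4 Rigidity of geometric endomorphisms and transfer of relations to `φ_E` -/

/-- **Rigidity in `End_{F̄}(V)`.** Two geometric endomorphisms of an elliptic curve which agree on
an infinite set of points are equal: their difference lies in `End_{F̄}(V)`, hence is `0` or
algebraic (`mem_geomEndRing_iff_holds`), and an algebraic map has finite kernel
(`IsAlgebraicOn.finite_ker`). Silverman, *AEC*, III.§4 (Cor. 4.9: a non-zero isogeny has finite
kernel). [cite: SilvermanAEC2009, III.4.9] -/
theorem eq_of_mem_geomEndRing_of_eqOn_infinite {F : Type u} [Field F] (V : WeierstrassCurve F)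
    [V.IsElliptic] {f g : AddMonoid.End V.geomPoints} (hf : f ∈ V.geomEndRing)
    (hg : g ∈ V.geomEndRing) {S : Set V.geomPoints} (hS : S.Infinite) (h : ∀ P ∈ S, f P = g P) :
    f = g := by
  have hδ : f - g ∈ V.geomEndRing := sub_mem hf hg
  rcases (mem_geomEndRing_iff_holds V (f - g)).mp hδ with h0 | halg
  · exact sub_eq_zero.mp h0
  · exfalso
    refine (hS.mono fun P hP ↦ ?_) (IsAlgebraicOn.finite_ker halg)
    change P ∈ ((f - g : AddMonoid.End V.geomPoints) : V.geomPoints →+ V.geomPoints).ker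
    rw [AddMonoidHom.mem_ker]
    change f P - g P = 0
    rw [h P hP, sub_self]

/-- `ι_* E(K̄) ⊆ E_E(K̄_E)` is infinite (`E(K̄)` is infinite for `E` elliptic — it contains `E[m]` of order `m²` for every
`m` prime to the characteristic, Silverman, *AEC*, Cor. III.6.4 — and `ι_*` is injective). [cite: SilvermanAEC2009, III.6.4 and VIII.§1] -/
theorem infinite_range_localPointsEquivGeomPoints_pointsMap (W : WeierstrassCurve K) [W.IsElliptic] :
    (Set.range fun P : W.geomPoints ↦ localPointsEquivGeomPoints W E (pointsMap W E P)).Infinite :=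
  Set.infinite_range_of_injective (Isogeny.localPointsEquivGeomPoints_pointsMap_injective E W)

namespace Isogeny

variable [W.IsElliptic] (φ : Isogeny W W)

/-- **Quadratic relations transfer to the base change.** If the endo-isogeny `φ` of the elliptic
curve `E/K` satisfies `φ(φP) + m·φP = c·P` on `E(K̄)` and `φ_E : E_E → E_E` is an `E`-isogeny with
`φ_E ∘ ι_* = ι_* ∘ φ` (e.g. the one of `exists_baseChange_field`), then `φ_E(φ_E Q) + m·φ_E Q = c·Q`
on ALL of `E_E(K̄_E)`: both sides are geometric endomorphisms agreeing on the infinite set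
`ι_* E(K̄)` (`eq_of_mem_geomEndRing_of_eqOn_infinite`). Used for CM generators (`η² + mη = c`).
Silverman, *AEC*, III.§4 (`End(E)` is a ring; Cor. III.4.9). [cite: SilvermanAEC2009, III.§4 (End(E)) and III.4.9] -/
theorem apply_apply_add_smul_of_baseChange_field {m c : ℤ}
    (hrel : ∀ P : W.geomPoints, φ (φ P) + m • φ P = c • P)
    (φE : Isogeny (W.baseChange E) (W.baseChange E))
    (hφE : ∀ P : W.geomPoints, φE (localPointsEquivGeomPoints W E (pointsMap W E P)) =
      localPointsEquivGeomPoints W E (pointsMap W E (φ P)))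
    (Q : geomPoints (W.baseChange E)) : φE (φE Q) + m • φE Q = c • Q := by
  haveI : (W.baseChange E).IsElliptic := inferInstanceAs ((W.map (algebraMap K E)).IsElliptic)
  set πE : AddMonoid.End (geomPoints (W.baseChange E)) := φE.toAddMonoidHom with hπE
  have hπEapp : ∀ R, πE R = φE R := fun _ ↦ rfl
  have hπEmem : πE ∈ (W.baseChange E).geomEndRing :=
    (W.baseChange E).endRing_le_geomEndRing φE.toAddMonoidHom_mem_endRing
  have hf : πE * πE + (m : AddMonoid.End (geomPoints (W.baseChange E))) * πE ∈
      (W.baseChange E).geomEndRing :=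
    add_mem (mul_mem hπEmem hπEmem) (mul_mem (intCast_mem _ m) hπEmem)
  have hg : ((c : ℤ) : AddMonoid.End (geomPoints (W.baseChange E))) ∈ (W.baseChange E).geomEndRing :=
    intCast_mem _ c
  have hfg : ∀ R, (πE * πE + (m : AddMonoid.End (geomPoints (W.baseChange E))) * πE) R =
      φE (φE R) + m • φE R := fun R ↦ by
    change πE (πE R) + ((m : AddMonoid.End (geomPoints (W.baseChange E))) : _ →+ _) (πE R) = _
    rw [AddMonoid.End.intCast_apply]
    rfl
  have key := eq_of_mem_geomEndRing_of_eqOn_infinite (W.baseChange E) hf hg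
    (infinite_range_localPointsEquivGeomPoints_pointsMap E W) (by
      rintro _ ⟨P, rfl⟩
      change (πE * πE + (m : AddMonoid.End (geomPoints (W.baseChange E))) * πE)
          (localPointsEquivGeomPoints W E (pointsMap W E P)) =
        ((c : AddMonoid.End (geomPoints (W.baseChange E))) : _ →+ _)
          (localPointsEquivGeomPoints W E (pointsMap W E P))
      rw [hfg, AddMonoid.End.intCast_apply, hφE, hφE, ← map_zsmul, ← map_zsmul, ← map_add,
        ← map_add, hrel, map_zsmul, map_zsmul])
  have hQ := congrArg (fun F : AddMonoid.End (geomPoints (W.baseChange E)) ↦ F Q) key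
  change (πE * πE + (m : AddMonoid.End (geomPoints (W.baseChange E))) * πE) Q =
    ((c : AddMonoid.End (geomPoints (W.baseChange E))) : _ →+ _) Q at hQ
  rwa [hfg, AddMonoid.End.intCast_apply] at hQ

/-- **`1 − φ` transfers to the base change.** If `ψ = 1 − φ` on `E(K̄)` (`ψ`, `φ` endo-isogenies of the
elliptic curve `E/K`, e.g. a CM endomorphism and its conjugate `π̄ = 1 − π`) and `ψ_E`, `φ_E` are
`E`-isogenies compatible with `ψ`, `φ` along `ι_*`, then `ψ_E = 1 − φ_E` on ALL of `E_E(K̄_E)`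
(rigidity on the infinite set `ι_* E(K̄)`). Silverman, *AEC*, III.§4 (`End(E)` is a ring).
[cite: SilvermanAEC2009, III.§4 (End(E)) and III.4.9] -/
theorem eq_sub_of_baseChange_field (ψ : Isogeny W W) (hψ : ∀ P : W.geomPoints, ψ P = P - φ P)
    (φE ψE : Isogeny (W.baseChange E) (W.baseChange E))
    (hφE : ∀ P : W.geomPoints, φE (localPointsEquivGeomPoints W E (pointsMap W E P)) =
      localPointsEquivGeomPoints W E (pointsMap W E (φ P)))
    (hψE : ∀ P : W.geomPoints, ψE (localPointsEquivGeomPoints W E (pointsMap W E P)) =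
      localPointsEquivGeomPoints W E (pointsMap W E (ψ P)))
    (Q : geomPoints (W.baseChange E)) : ψE Q = Q - φE Q := by
  haveI : (W.baseChange E).IsElliptic := inferInstanceAs ((W.map (algebraMap K E)).IsElliptic)
  set πE : AddMonoid.End (geomPoints (W.baseChange E)) := φE.toAddMonoidHom with hπE
  set ρE : AddMonoid.End (geomPoints (W.baseChange E)) := ψE.toAddMonoidHom with hρE
  have hπEmem : πE ∈ (W.baseChange E).geomEndRing :=
    (W.baseChange E).endRing_le_geomEndRing φE.toAddMonoidHom_mem_endRing
  have hρEmem : ρE ∈ (W.baseChange E).geomEndRing :=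
    (W.baseChange E).endRing_le_geomEndRing ψE.toAddMonoidHom_mem_endRing
  have hg : (1 : AddMonoid.End (geomPoints (W.baseChange E))) - πE ∈ (W.baseChange E).geomEndRing :=
    sub_mem (one_mem _) hπEmem
  have h1 : ∀ R, ((1 : AddMonoid.End (geomPoints (W.baseChange E))) - πE) R = R - φE R :=
    fun R ↦ rfl
  have key := eq_of_mem_geomEndRing_of_eqOn_infinite (W.baseChange E) hρEmem hg
    (infinite_range_localPointsEquivGeomPoints_pointsMap E W) (by
      rintro _ ⟨P, rfl⟩
      rw [h1]
      change ψE (localPointsEquivGeomPoints W E (pointsMap W E P)) = _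
      rw [hψE, hφE, hψ, map_sub, map_sub])
  have hQ := congrArg (fun F : AddMonoid.End (geomPoints (W.baseChange E)) ↦ F Q) key
  change ψE Q = ((1 : AddMonoid.End (geomPoints (W.baseChange E))) - πE) Q at hQ
  rwa [h1] at hQ

/-- Hence, for any `π_E ∈ AddMonoid.End E_E(K̄_E)` agreeing with such a `φ_E`, `#ker(1 − π_E) = #ker ψ_E`
(and `= #ker ψ` by `exists_baseChange_field`): the kernels coincide as sets.
[cite: SilvermanAEC2009, III.4.9] -/
theorem natCard_ker_one_sub_of_baseChange_field (ψ : Isogeny W W)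
    (hψ : ∀ P : W.geomPoints, ψ P = P - φ P)
    (φE ψE : Isogeny (W.baseChange E) (W.baseChange E))
    (hφE : ∀ P : W.geomPoints, φE (localPointsEquivGeomPoints W E (pointsMap W E P)) =
      localPointsEquivGeomPoints W E (pointsMap W E (φ P)))
    (hψE : ∀ P : W.geomPoints, ψE (localPointsEquivGeomPoints W E (pointsMap W E P)) =
      localPointsEquivGeomPoints W E (pointsMap W E (ψ P)))
    (πE : AddMonoid.End (geomPoints (W.baseChange E))) (hπE : ∀ Q, πE Q = φE Q) :
    Nat.card ((1 - πE : AddMonoid.End (geomPoints (W.baseChange E))) :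
        geomPoints (W.baseChange E) →+ geomPoints (W.baseChange E)).ker =
      Nat.card ψE.toAddMonoidHom.ker := by
  refine Nat.card_congr (Equiv.subtypeEquiv (Equiv.refl _) fun Q ↦ ?_)
  rw [Equiv.refl_apply, AddMonoidHom.mem_ker, AddMonoidHom.mem_ker]
  change Q - πE Q = 0 ↔ ψE Q = 0
  rw [hπE, φ.eq_sub_of_baseChange_field E ψ hψ φE ψE hφE hψE Q]

end Isogeny

end WeierstrassCurve
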